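import Summits.RiemannHypothesis.RiemannHypothesis.Theorems.WeilFormatCCinfDoorPoly
import HarnessLib

/-!
# Format C, design C∞ (E3, analytic side): the EXACT MIDDLE RANGE of the front door as ONE quadratic form

Route context: Fourier–Galerkin / Schur-complement certificates of Weil positivity on a window ("format C", C∞ door;
cell memo `run/shared/lean/pub/rh-explicit/rh-explicit-weil-10/KERNEL-LEVER.md` §22; supporting stmt-RiemannHypothesis-0098;
seat rh-explicit-weil-10).  The hypothesis `hfine` (`hfino`) of `weilPositivityOn_of_cinf_poly` bounds the exact middle range
`Σ_{m∈[B+1,m₀)} (g_m·z)²/d̂(m)` of the coupling column by a form `Ufin(x,β)`, where the three-part column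
`g_m·z = Σ_i M⁺(i,m)x_i + Σ_j Re W(1f_j − proj_B 1f_j, w⁺_m)/√2·β_j − Σ_j V_j(m)(Λ₁x + Λ₂β)_j` carries the PROJECTED profile
images.  Here the projection is resolved (`WeilFormatCCinfImageGlue`: `X_j(m) − Σ_{n≤B} M⁺(n,m)V_j(n)`), the column is written as
ONE linear form `Σ_k g_m(k) z_k` on `Fin (B+1) ⊕ Fin r`, and `Ufin` is taken to be the EXACT weighted Gram
`T(k,k') = Σ_m g_m(k)g_m(k')/w_m` for any per-mode weights `0 < w_m ≤ d̂(m)`: every entry of `T` is a finite sum of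
products of boxable objects, so it joins the single boxed matrix of the rung's PSD check
(`WeilFormatCCinfMajorantForm`, `WeilFormatCCinfMarginForm`).

* `columns_majorant_sum`, `threePart_linearForm_eq` — generic algebra;
* `cinf_hfin_even` / `cinf_hfin_odd` — LITERALLY the `hfine` / `hfino` hypotheses of `weilPositivityOn_of_cinf_poly` for
  `Ufine := zᵀTz` (resp. `Ufino`), from the weights.

Elementary; standard axioms; no definitions; no RH claim.
-/

set_option autoImplicit false
-- `Summit.RiemannHypothesis.RiemannHypothesis.…` is the layout-mandated namespace (summit = problem name).
set_option linter.dupNamespace false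

noncomputable section

open Complex Filter Set MeasureTheory Finset
open scoped Real Topology ComplexConjugate

namespace Summit.RiemannHypothesis.RiemannHypothesis.Theorems.WeilFormatC

open Literature.NumberTheory.LFunctions Literature.NumberTheory.LFunctions.Yoshida1992

variable {a : ℝ}

/-! ## Generic algebra -/

/-- **Exact columns with lower weights majorise** (`Sum`-indexed columns): for `0 < w_m ≤ d̂_m` on `s`,
`Σ_{m∈s} (Σ_k g_m(k)z_k)²/d̂_m ≤ Σ_k Σ_{k'} z_k z_{k'} Σ_{m∈s} g_m(k)g_m(k')/w_m`. -/
theorem columns_majorant_sum {κ : Type*} [Fintype κ] (s : Finset ℕ) (g : ℕ → κ → ℝ) (dhat w : ℕ → ℝ)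
    (hw : ∀ m ∈ s, 0 < w m ∧ w m ≤ dhat m) (z : κ → ℝ) :
    ∑ m ∈ s, (∑ k, g m k * z k) ^ 2 / dhat m
      ≤ ∑ k, ∑ k', z k * z k' * ∑ m ∈ s, g m k * g m k' / w m := by
  have key : ∀ m, (∑ k, g m k * z k) ^ 2 / w m = ∑ k, ∑ k', z k * z k' * (g m k * g m k' / w m) := by
    intro m
    rw [sq, Finset.sum_mul_sum, Finset.sum_div]
    refine Finset.sum_congr rfl fun k _ ↦ ?_
    rw [Finset.sum_div]
    exact Finset.sum_congr rfl fun k' _ ↦ by ring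
  have e : ∑ k, ∑ k', z k * z k' * ∑ m ∈ s, g m k * g m k' / w m = ∑ m ∈ s, (∑ k, g m k * z k) ^ 2 / w m := by
    simp only [Finset.mul_sum]
    rw [Finset.sum_congr rfl fun k _ ↦ Finset.sum_comm, Finset.sum_comm]
    exact Finset.sum_congr rfl fun m _ ↦ (key m).symm
  rw [e]
  refine Finset.sum_le_sum fun m hm ↦ ?_
  exact div_le_div_of_nonneg_left (sq_nonneg _) (hw m hm).1 (hw m hm).2

/-- **The three-part column as ONE linear form**:
`Σ_i a_i x_i + Σ_j b_j β_j − Σ_j v_j (Σ_i Λ₁(j,i)x_i + Σ_{j'} Λ₂(j,j')β_{j'}) = Σ_k g(k) z_k` with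
`g = (a − Λ₁ᵀv, b − Λ₂ᵀv)`, `z = (x, β)`. -/
theorem threePart_linearForm_eq {B r : ℕ} (av : Fin B → ℝ) (bv : Fin r → ℝ) (v : Fin r → ℝ)
    (Λ1 : Fin r → Fin B → ℝ) (Λ2 : Fin r → Fin r → ℝ) (x : Fin B → ℝ) (β : Fin r → ℝ) :
    ∑ i, av i * x i + ∑ j, bv j * β j - ∑ j, v j * (∑ i, Λ1 j i * x i + ∑ j', Λ2 j j' * β j')
      = ∑ k, Sum.elim (fun i ↦ av i - ∑ j, v j * Λ1 j i) (fun j' ↦ bv j' - ∑ j, v j * Λ2 j j') k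
          * Sum.elim x β k := by
  rw [Fintype.sum_sum_type]
  simp only [Sum.elim_inl, Sum.elim_inr]
  have h1 : ∑ j, v j * (∑ i, Λ1 j i * x i + ∑ j', Λ2 j j' * β j')
      = ∑ i, (∑ j, v j * Λ1 j i) * x i + ∑ j', (∑ j, v j * Λ2 j j') * β j' := by
    simp only [mul_add, Finset.sum_add_distrib, Finset.mul_sum, Finset.sum_mul]
    congr 1
    · rw [Finset.sum_comm]
      exact Finset.sum_congr rfl fun i _ ↦ Finset.sum_congr rfl fun j _ ↦ by ring
    · rw [Finset.sum_comm]
      exact Finset.sum_congr rfl fun j' _ ↦ Finset.sum_congr rfl fun j _ ↦ by ring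
  rw [h1]
  simp only [sub_mul, Finset.sum_sub_distrib]
  ring

/-! ## The `hfin` hypotheses of the front door -/

/-- **`hfine` of `weilPositivityOn_of_cinf_poly` with `Ufine := zᵀTz`**, `T(k,k') = Σ_{m∈[Be+1,m₀e)} g_m(k)g_m(k')/w_m` the
exact weighted Gram of the RESOLVED three-part columns `g_m = (M⁺(·,m) − Σ_j V_j(m)Λ₁(j,·) ∣ X_·(m) − Σ_{n≤B} M⁺(n,m)V_·(n) −
Σ_j V_j(m)Λ₂(j,·))`, for any weights `0 < w_m ≤ d̂(m)` (even polynomial profiles). -/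
theorem cinf_hfin_even (ha : 0 < a) {Be re m₀e : ℕ} (se : Finset ℕ) (hse : ∀ q ∈ se, Even q)
    (coefe : Fin re → ℕ → ℝ) (Λ1e : Fin re → Fin (Be + 1) → ℝ) (Λ2e : Fin re → Fin re → ℝ)
    (de w : ℕ → ℝ) (hw : ∀ m ∈ Finset.Ico (Be + 1) m₀e, 0 < w m ∧ w m ≤ de m)
    (x : Fin (Be + 1) → ℝ) (β : Fin re → ℝ) :
    ∑ m ∈ Finset.Ico (Be + 1) m₀e,
        (∑ i : Fin (Be + 1), (if (i : ℕ) = 0 then gramCoeff a 0 m else if m = 0 then gramCoeff a i 0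
            else (gramCoeff a i m + gramCoeff a i (-(m : ℤ))) / 2) * x i
          + ∑ j, ((weilWindowSesq a ((Icc (-a) a).indicator (fun x : ℝ ↦ ∑ q ∈ se, ((coefe j q : ℝ) : ℂ) * ((x : ℂ)) ^ q)
              - proj a Be ((Icc (-a) a).indicator fun x : ℝ ↦ ∑ q ∈ se, ((coefe j q : ℝ) : ℂ) * ((x : ℂ)) ^ q))
              (chiEven a m)).re / (if m = 0 then 1 else Real.sqrt 2)) * β j
          - ∑ j, ((if m = 0 then 1 else 2) * (Yoshida1992.fourierCoeff a m ((Icc (-a) a).indicator fun x : ℝ ↦ ∑ q ∈ se, ((coefe j q : ℝ) : ℂ) * ((x : ℂ)) ^ q)).re / Real.sqrt (2 * a))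
              * (∑ i, Λ1e j i * x i + ∑ j', Λ2e j j' * β j')) ^ 2 / de m
      ≤ ∑ k, ∑ k', Sum.elim x β k * Sum.elim x β k' *
          ∑ m ∈ Finset.Ico (Be + 1) m₀e,
            Sum.elim
                (fun i : Fin (Be + 1) ↦ (if (i : ℕ) = 0 then gramCoeff a 0 m else if m = 0 then gramCoeff a i 0
            else (gramCoeff a i m + gramCoeff a i (-(m : ℤ))) / 2)
                  - ∑ j, ((if m = 0 then 1 else 2) * (Yoshida1992.fourierCoeff a m ((Icc (-a) a).indicator fun x : ℝ ↦ ∑ q ∈ se, ((coefe j q : ℝ) : ℂ) * ((x : ℂ)) ^ q)).re / Real.sqrt (2 * a)) * Λ1e j i)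
                (fun j' : Fin re ↦ (((weilWindowSesq a ((Icc (-a) a).indicator fun x : ℝ ↦ ∑ q ∈ se, ((coefe j' q : ℝ) : ℂ) * ((x : ℂ)) ^ q) (chiEven a m)).re / (if m = 0 then 1 else Real.sqrt 2))
                - ∑ n ∈ Finset.range (Be + 1), (if n = 0 then gramCoeff a 0 m else if m = 0 then gramCoeff a n 0 else (gramCoeff a n m + gramCoeff a n (-((m) : ℤ))) / 2) * ((if n = 0 then 1 else 2) * (Yoshida1992.fourierCoeff a n ((Icc (-a) a).indicator fun x : ℝ ↦ ∑ q ∈ se, ((coefe j' q : ℝ) : ℂ) * ((x : ℂ)) ^ q)).re / Real.sqrt (2 * a)))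
                  - ∑ j, ((if m = 0 then 1 else 2) * (Yoshida1992.fourierCoeff a m ((Icc (-a) a).indicator fun x : ℝ ↦ ∑ q ∈ se, ((coefe j q : ℝ) : ℂ) * ((x : ℂ)) ^ q)).re / Real.sqrt (2 * a)) * Λ2e j j') k
            * Sum.elim
                (fun i : Fin (Be + 1) ↦ (if (i : ℕ) = 0 then gramCoeff a 0 m else if m = 0 then gramCoeff a i 0
            else (gramCoeff a i m + gramCoeff a i (-(m : ℤ))) / 2)
                  - ∑ j, ((if m = 0 then 1 else 2) * (Yoshida1992.fourierCoeff a m ((Icc (-a) a).indicator fun x : ℝ ↦ ∑ q ∈ se, ((coefe j q : ℝ) : ℂ) * ((x : ℂ)) ^ q)).re / Real.sqrt (2 * a)) * Λ1e j i)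
                (fun j' : Fin re ↦ (((weilWindowSesq a ((Icc (-a) a).indicator fun x : ℝ ↦ ∑ q ∈ se, ((coefe j' q : ℝ) : ℂ) * ((x : ℂ)) ^ q) (chiEven a m)).re / (if m = 0 then 1 else Real.sqrt 2))
                - ∑ n ∈ Finset.range (Be + 1), (if n = 0 then gramCoeff a 0 m else if m = 0 then gramCoeff a n 0 else (gramCoeff a n m + gramCoeff a n (-((m) : ℤ))) / 2) * ((if n = 0 then 1 else 2) * (Yoshida1992.fourierCoeff a n ((Icc (-a) a).indicator fun x : ℝ ↦ ∑ q ∈ se, ((coefe j' q : ℝ) : ℂ) * ((x : ℂ)) ^ q)).re / Real.sqrt (2 * a)))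
                  - ∑ j, ((if m = 0 then 1 else 2) * (Yoshida1992.fourierCoeff a m ((Icc (-a) a).indicator fun x : ℝ ↦ ∑ q ∈ se, ((coefe j q : ℝ) : ℂ) * ((x : ℂ)) ^ q)).re / Real.sqrt (2 * a)) * Λ2e j j') k' / w m := by
  have hev : ∀ j : Fin re, ∀ x : ℝ, (fun x : ℝ ↦ ∑ q ∈ se, ((coefe j q : ℝ) : ℂ) * ((x : ℂ)) ^ q) (-x)
      = (fun x : ℝ ↦ ∑ q ∈ se, ((coefe j q : ℝ) : ℂ) * ((x : ℂ)) ^ q) x := fun j ↦ (poly_even_real se (coefe j) hse).1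
  have hre : ∀ j : Fin re, ∀ x : ℝ, conj ((fun x : ℝ ↦ ∑ q ∈ se, ((coefe j q : ℝ) : ℂ) * ((x : ℂ)) ^ q) x)
      = (fun x : ℝ ↦ ∑ q ∈ se, ((coefe j q : ℝ) : ℂ) * ((x : ℂ)) ^ q) x := fun j ↦ (poly_even_real se (coefe j) hse).2
  have hevI : ∀ j : Fin re, ∀ x : ℝ, ((Icc (-a) a).indicator fun x : ℝ ↦ ∑ q ∈ se, ((coefe j q : ℝ) : ℂ) * ((x : ℂ)) ^ q) (-x) = ((Icc (-a) a).indicator fun x : ℝ ↦ ∑ q ∈ se, ((coefe j q : ℝ) : ℂ) * ((x : ℂ)) ^ q) x :=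
    fun j ↦ indicator_even (f := fun x : ℝ ↦ ∑ q ∈ se, ((coefe j q : ℝ) : ℂ) * ((x : ℂ)) ^ q) (hev j) a
  have hreI : ∀ j : Fin re, ∀ x : ℝ, conj (((Icc (-a) a).indicator fun x : ℝ ↦ ∑ q ∈ se, ((coefe j q : ℝ) : ℂ) * ((x : ℂ)) ^ q) x) = ((Icc (-a) a).indicator fun x : ℝ ↦ ∑ q ∈ se, ((coefe j q : ℝ) : ℂ) * ((x : ℂ)) ^ q) x :=
    fun j ↦ indicator_real (f := fun x : ℝ ↦ ∑ q ∈ se, ((coefe j q : ℝ) : ℂ) * ((x : ℂ)) ^ q) (hre j) a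
  have hwin : ∀ j : Fin re, IsWindowFunction a ((Icc (-a) a).indicator fun x : ℝ ↦ ∑ q ∈ se, ((coefe j q : ℝ) : ℂ) * ((x : ℂ)) ^ q) := fun j ↦ isWindowFunction_indicator_poly a se _
  have hsum : ∀ m ∈ Finset.Ico (Be + 1) m₀e,
      (∑ i : Fin (Be + 1), (if (i : ℕ) = 0 then gramCoeff a 0 m else if m = 0 then gramCoeff a i 0
            else (gramCoeff a i m + gramCoeff a i (-(m : ℤ))) / 2) * x i
          + ∑ j, ((weilWindowSesq a ((Icc (-a) a).indicator (fun x : ℝ ↦ ∑ q ∈ se, ((coefe j q : ℝ) : ℂ) * ((x : ℂ)) ^ q)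
              - proj a Be ((Icc (-a) a).indicator fun x : ℝ ↦ ∑ q ∈ se, ((coefe j q : ℝ) : ℂ) * ((x : ℂ)) ^ q))
              (chiEven a m)).re / (if m = 0 then 1 else Real.sqrt 2)) * β j
          - ∑ j, ((if m = 0 then 1 else 2) * (Yoshida1992.fourierCoeff a m ((Icc (-a) a).indicator fun x : ℝ ↦ ∑ q ∈ se, ((coefe j q : ℝ) : ℂ) * ((x : ℂ)) ^ q)).re / Real.sqrt (2 * a))
              * (∑ i, Λ1e j i * x i + ∑ j', Λ2e j j' * β j')) ^ 2 / de m
        = (∑ k, Sum.elim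
                (fun i : Fin (Be + 1) ↦ (if (i : ℕ) = 0 then gramCoeff a 0 m else if m = 0 then gramCoeff a i 0
            else (gramCoeff a i m + gramCoeff a i (-(m : ℤ))) / 2)
                  - ∑ j, ((if m = 0 then 1 else 2) * (Yoshida1992.fourierCoeff a m ((Icc (-a) a).indicator fun x : ℝ ↦ ∑ q ∈ se, ((coefe j q : ℝ) : ℂ) * ((x : ℂ)) ^ q)).re / Real.sqrt (2 * a)) * Λ1e j i)
                (fun j' : Fin re ↦ (((weilWindowSesq a ((Icc (-a) a).indicator fun x : ℝ ↦ ∑ q ∈ se, ((coefe j' q : ℝ) : ℂ) * ((x : ℂ)) ^ q) (chiEven a m)).re / (if m = 0 then 1 else Real.sqrt 2))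
                - ∑ n ∈ Finset.range (Be + 1), (if n = 0 then gramCoeff a 0 m else if m = 0 then gramCoeff a n 0 else (gramCoeff a n m + gramCoeff a n (-((m) : ℤ))) / 2) * ((if n = 0 then 1 else 2) * (Yoshida1992.fourierCoeff a n ((Icc (-a) a).indicator fun x : ℝ ↦ ∑ q ∈ se, ((coefe j' q : ℝ) : ℂ) * ((x : ℂ)) ^ q)).re / Real.sqrt (2 * a)))
                  - ∑ j, ((if m = 0 then 1 else 2) * (Yoshida1992.fourierCoeff a m ((Icc (-a) a).indicator fun x : ℝ ↦ ∑ q ∈ se, ((coefe j q : ℝ) : ℂ) * ((x : ℂ)) ^ q)).re / Real.sqrt (2 * a)) * Λ2e j j') k * Sum.elim x β k) ^ 2 / de m := by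
    intro m hm
    have hBm : Be < m := by rw [Finset.mem_Ico] at hm; omega
    have h1 : ∑ j, ((weilWindowSesq a ((Icc (-a) a).indicator (fun x : ℝ ↦ ∑ q ∈ se, ((coefe j q : ℝ) : ℂ) * ((x : ℂ)) ^ q)
              - proj a Be ((Icc (-a) a).indicator fun x : ℝ ↦ ∑ q ∈ se, ((coefe j q : ℝ) : ℂ) * ((x : ℂ)) ^ q))
              (chiEven a m)).re / (if m = 0 then 1 else Real.sqrt 2)) * β j
        = ∑ j, (((weilWindowSesq a ((Icc (-a) a).indicator fun x : ℝ ↦ ∑ q ∈ se, ((coefe j q : ℝ) : ℂ) * ((x : ℂ)) ^ q) (chiEven a m)).re / (if m = 0 then 1 else Real.sqrt 2))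
                - ∑ n ∈ Finset.range (Be + 1), (if n = 0 then gramCoeff a 0 m else if m = 0 then gramCoeff a n 0 else (gramCoeff a n m + gramCoeff a n (-((m) : ℤ))) / 2) * ((if n = 0 then 1 else 2) * (Yoshida1992.fourierCoeff a n ((Icc (-a) a).indicator fun x : ℝ ↦ ∑ q ∈ se, ((coefe j q : ℝ) : ℂ) * ((x : ℂ)) ^ q)).re / Real.sqrt (2 * a))) * β j :=
      Finset.sum_congr rfl fun j _ ↦ by rw [re_weilWindowSesq_sub_proj_chiEven_div ha (hevI j) (hreI j) (hwin j) hBm]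
    have h2 := threePart_linearForm_eq (fun i : Fin (Be + 1) ↦ (if (i : ℕ) = 0 then gramCoeff a 0 m else if m = 0 then gramCoeff a i 0
            else (gramCoeff a i m + gramCoeff a i (-(m : ℤ))) / 2))
      (fun j : Fin re ↦ (((weilWindowSesq a ((Icc (-a) a).indicator fun x : ℝ ↦ ∑ q ∈ se, ((coefe j q : ℝ) : ℂ) * ((x : ℂ)) ^ q) (chiEven a m)).re / (if m = 0 then 1 else Real.sqrt 2))
                - ∑ n ∈ Finset.range (Be + 1), (if n = 0 then gramCoeff a 0 m else if m = 0 then gramCoeff a n 0 else (gramCoeff a n m + gramCoeff a n (-((m) : ℤ))) / 2) * ((if n = 0 then 1 else 2) * (Yoshida1992.fourierCoeff a n ((Icc (-a) a).indicator fun x : ℝ ↦ ∑ q ∈ se, ((coefe j q : ℝ) : ℂ) * ((x : ℂ)) ^ q)).re / Real.sqrt (2 * a))))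
      (fun j : Fin re ↦ ((if m = 0 then 1 else 2) * (Yoshida1992.fourierCoeff a m ((Icc (-a) a).indicator fun x : ℝ ↦ ∑ q ∈ se, ((coefe j q : ℝ) : ℂ) * ((x : ℂ)) ^ q)).re / Real.sqrt (2 * a))) Λ1e Λ2e x β
    beta_reduce at h2
    rw [h1, h2]
  rw [Finset.sum_congr rfl hsum]
  exact columns_majorant_sum (Finset.Ico (Be + 1) m₀e) (fun m ↦ Sum.elim
                (fun i : Fin (Be + 1) ↦ (if (i : ℕ) = 0 then gramCoeff a 0 m else if m = 0 then gramCoeff a i 0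
            else (gramCoeff a i m + gramCoeff a i (-(m : ℤ))) / 2)
                  - ∑ j, ((if m = 0 then 1 else 2) * (Yoshida1992.fourierCoeff a m ((Icc (-a) a).indicator fun x : ℝ ↦ ∑ q ∈ se, ((coefe j q : ℝ) : ℂ) * ((x : ℂ)) ^ q)).re / Real.sqrt (2 * a)) * Λ1e j i)
                (fun j' : Fin re ↦ (((weilWindowSesq a ((Icc (-a) a).indicator fun x : ℝ ↦ ∑ q ∈ se, ((coefe j' q : ℝ) : ℂ) * ((x : ℂ)) ^ q) (chiEven a m)).re / (if m = 0 then 1 else Real.sqrt 2))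
                - ∑ n ∈ Finset.range (Be + 1), (if n = 0 then gramCoeff a 0 m else if m = 0 then gramCoeff a n 0 else (gramCoeff a n m + gramCoeff a n (-((m) : ℤ))) / 2) * ((if n = 0 then 1 else 2) * (Yoshida1992.fourierCoeff a n ((Icc (-a) a).indicator fun x : ℝ ↦ ∑ q ∈ se, ((coefe j' q : ℝ) : ℂ) * ((x : ℂ)) ^ q)).re / Real.sqrt (2 * a)))
                  - ∑ j, ((if m = 0 then 1 else 2) * (Yoshida1992.fourierCoeff a m ((Icc (-a) a).indicator fun x : ℝ ↦ ∑ q ∈ se, ((coefe j q : ℝ) : ℂ) * ((x : ℂ)) ^ q)).re / Real.sqrt (2 * a)) * Λ2e j j')) de w hw (Sum.elim x β)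

/-- **`hfino` of `weilPositivityOn_of_cinf_poly` with `Ufino := zᵀTz`** (odd sector: kernel index `m` ↔ mode `m+1`;
images `Y_j(m) = Im W(1f_j, w⁻_{m+1})/√2` resolved by `im_weilWindowSesq_sub_proj_chiOdd_div`; tables
`V⁻_j(m) = 2 Im ĉ_{m+1}(1f_j)/√(2a)`). -/
theorem cinf_hfin_odd (ha : 0 < a) {Bo ro m₀o : ℕ} (so : Finset ℕ) (hso : ∀ q ∈ so, Odd q)
    (coefo : Fin ro → ℕ → ℝ) (Λ1o : Fin ro → Fin Bo → ℝ) (Λ2o : Fin ro → Fin ro → ℝ)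
    (dod w : ℕ → ℝ) (hw : ∀ m ∈ Finset.Ico Bo m₀o, 0 < w m ∧ w m ≤ dod m)
    (x : Fin Bo → ℝ) (β : Fin ro → ℝ) :
    ∑ m ∈ Finset.Ico Bo m₀o,
        (∑ i : Fin Bo, ((gramCoeff a (((i : ℕ) : ℤ) + 1) ((m : ℤ) + 1) - gramCoeff a (((i : ℕ) : ℤ) + 1) (-((m : ℤ) + 1))) / 2) * x i
          + ∑ j, ((weilWindowSesq a ((Icc (-a) a).indicator (fun x : ℝ ↦ ∑ q ∈ so, ((coefo j q : ℝ) : ℂ) * ((x : ℂ)) ^ q)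
              - proj a Bo ((Icc (-a) a).indicator fun x : ℝ ↦ ∑ q ∈ so, ((coefo j q : ℝ) : ℂ) * ((x : ℂ)) ^ q))
              (chiOdd a (m + 1))).im / Real.sqrt 2) * β j
          - ∑ j, (2 * (Yoshida1992.fourierCoeff a ((m : ℤ) + 1) ((Icc (-a) a).indicator fun x : ℝ ↦ ∑ q ∈ so, ((coefo j q : ℝ) : ℂ) * ((x : ℂ)) ^ q)).im / Real.sqrt (2 * a))
              * (∑ i, Λ1o j i * x i + ∑ j', Λ2o j j' * β j')) ^ 2 / dod m
      ≤ ∑ k, ∑ k', Sum.elim x β k * Sum.elim x β k' *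
          ∑ m ∈ Finset.Ico Bo m₀o,
            Sum.elim
                (fun i : Fin Bo ↦ ((gramCoeff a (((i : ℕ) : ℤ) + 1) ((m : ℤ) + 1) - gramCoeff a (((i : ℕ) : ℤ) + 1) (-((m : ℤ) + 1))) / 2)
                  - ∑ j, (2 * (Yoshida1992.fourierCoeff a ((m : ℤ) + 1) ((Icc (-a) a).indicator fun x : ℝ ↦ ∑ q ∈ so, ((coefo j q : ℝ) : ℂ) * ((x : ℂ)) ^ q)).im / Real.sqrt (2 * a)) * Λ1o j i)
                (fun j' : Fin ro ↦ (((weilWindowSesq a ((Icc (-a) a).indicator fun x : ℝ ↦ ∑ q ∈ so, ((coefo j' q : ℝ) : ℂ) * ((x : ℂ)) ^ q) (chiOdd a (m + 1))).im / Real.sqrt 2)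
                - ∑ k ∈ Finset.Ico 0 Bo, ((gramCoeff a ((k : ℤ) + 1) ((m : ℤ) + 1) - gramCoeff a ((k : ℤ) + 1) (-((m : ℤ) + 1))) / 2) * (2 * (Yoshida1992.fourierCoeff a ((k : ℤ) + 1) ((Icc (-a) a).indicator fun x : ℝ ↦ ∑ q ∈ so, ((coefo j' q : ℝ) : ℂ) * ((x : ℂ)) ^ q)).im / Real.sqrt (2 * a)))
                  - ∑ j, (2 * (Yoshida1992.fourierCoeff a ((m : ℤ) + 1) ((Icc (-a) a).indicator fun x : ℝ ↦ ∑ q ∈ so, ((coefo j q : ℝ) : ℂ) * ((x : ℂ)) ^ q)).im / Real.sqrt (2 * a)) * Λ2o j j') k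
            * Sum.elim
                (fun i : Fin Bo ↦ ((gramCoeff a (((i : ℕ) : ℤ) + 1) ((m : ℤ) + 1) - gramCoeff a (((i : ℕ) : ℤ) + 1) (-((m : ℤ) + 1))) / 2)
                  - ∑ j, (2 * (Yoshida1992.fourierCoeff a ((m : ℤ) + 1) ((Icc (-a) a).indicator fun x : ℝ ↦ ∑ q ∈ so, ((coefo j q : ℝ) : ℂ) * ((x : ℂ)) ^ q)).im / Real.sqrt (2 * a)) * Λ1o j i)
                (fun j' : Fin ro ↦ (((weilWindowSesq a ((Icc (-a) a).indicator fun x : ℝ ↦ ∑ q ∈ so, ((coefo j' q : ℝ) : ℂ) * ((x : ℂ)) ^ q) (chiOdd a (m + 1))).im / Real.sqrt 2)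
                - ∑ k ∈ Finset.Ico 0 Bo, ((gramCoeff a ((k : ℤ) + 1) ((m : ℤ) + 1) - gramCoeff a ((k : ℤ) + 1) (-((m : ℤ) + 1))) / 2) * (2 * (Yoshida1992.fourierCoeff a ((k : ℤ) + 1) ((Icc (-a) a).indicator fun x : ℝ ↦ ∑ q ∈ so, ((coefo j' q : ℝ) : ℂ) * ((x : ℂ)) ^ q)).im / Real.sqrt (2 * a)))
                  - ∑ j, (2 * (Yoshida1992.fourierCoeff a ((m : ℤ) + 1) ((Icc (-a) a).indicator fun x : ℝ ↦ ∑ q ∈ so, ((coefo j q : ℝ) : ℂ) * ((x : ℂ)) ^ q)).im / Real.sqrt (2 * a)) * Λ2o j j') k' / w m := by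
  have hod : ∀ j : Fin ro, ∀ x : ℝ, (fun x : ℝ ↦ ∑ q ∈ so, ((coefo j q : ℝ) : ℂ) * ((x : ℂ)) ^ q) (-x)
      = -(fun x : ℝ ↦ ∑ q ∈ so, ((coefo j q : ℝ) : ℂ) * ((x : ℂ)) ^ q) x := fun j ↦ (poly_odd_real so (coefo j) hso).1
  have hre : ∀ j : Fin ro, ∀ x : ℝ, conj ((fun x : ℝ ↦ ∑ q ∈ so, ((coefo j q : ℝ) : ℂ) * ((x : ℂ)) ^ q) x)
      = (fun x : ℝ ↦ ∑ q ∈ so, ((coefo j q : ℝ) : ℂ) * ((x : ℂ)) ^ q) x := fun j ↦ (poly_odd_real so (coefo j) hso).2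
  have hodI : ∀ j : Fin ro, ∀ x : ℝ, ((Icc (-a) a).indicator fun x : ℝ ↦ ∑ q ∈ so, ((coefo j q : ℝ) : ℂ) * ((x : ℂ)) ^ q) (-x) = -((Icc (-a) a).indicator fun x : ℝ ↦ ∑ q ∈ so, ((coefo j q : ℝ) : ℂ) * ((x : ℂ)) ^ q) x :=
    fun j ↦ indicator_odd (f := fun x : ℝ ↦ ∑ q ∈ so, ((coefo j q : ℝ) : ℂ) * ((x : ℂ)) ^ q) (hod j) a
  have hreI : ∀ j : Fin ro, ∀ x : ℝ, conj (((Icc (-a) a).indicator fun x : ℝ ↦ ∑ q ∈ so, ((coefo j q : ℝ) : ℂ) * ((x : ℂ)) ^ q) x) = ((Icc (-a) a).indicator fun x : ℝ ↦ ∑ q ∈ so, ((coefo j q : ℝ) : ℂ) * ((x : ℂ)) ^ q) x :=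
    fun j ↦ indicator_real (f := fun x : ℝ ↦ ∑ q ∈ so, ((coefo j q : ℝ) : ℂ) * ((x : ℂ)) ^ q) (hre j) a
  have hwin : ∀ j : Fin ro, IsWindowFunction a ((Icc (-a) a).indicator fun x : ℝ ↦ ∑ q ∈ so, ((coefo j q : ℝ) : ℂ) * ((x : ℂ)) ^ q) := fun j ↦ isWindowFunction_indicator_poly a so _
  have hsum : ∀ m ∈ Finset.Ico Bo m₀o,
      (∑ i : Fin Bo, ((gramCoeff a (((i : ℕ) : ℤ) + 1) ((m : ℤ) + 1) - gramCoeff a (((i : ℕ) : ℤ) + 1) (-((m : ℤ) + 1))) / 2) * x i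
          + ∑ j, ((weilWindowSesq a ((Icc (-a) a).indicator (fun x : ℝ ↦ ∑ q ∈ so, ((coefo j q : ℝ) : ℂ) * ((x : ℂ)) ^ q)
              - proj a Bo ((Icc (-a) a).indicator fun x : ℝ ↦ ∑ q ∈ so, ((coefo j q : ℝ) : ℂ) * ((x : ℂ)) ^ q))
              (chiOdd a (m + 1))).im / Real.sqrt 2) * β j
          - ∑ j, (2 * (Yoshida1992.fourierCoeff a ((m : ℤ) + 1) ((Icc (-a) a).indicator fun x : ℝ ↦ ∑ q ∈ so, ((coefo j q : ℝ) : ℂ) * ((x : ℂ)) ^ q)).im / Real.sqrt (2 * a))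
              * (∑ i, Λ1o j i * x i + ∑ j', Λ2o j j' * β j')) ^ 2 / dod m
        = (∑ k, Sum.elim
                (fun i : Fin Bo ↦ ((gramCoeff a (((i : ℕ) : ℤ) + 1) ((m : ℤ) + 1) - gramCoeff a (((i : ℕ) : ℤ) + 1) (-((m : ℤ) + 1))) / 2)
                  - ∑ j, (2 * (Yoshida1992.fourierCoeff a ((m : ℤ) + 1) ((Icc (-a) a).indicator fun x : ℝ ↦ ∑ q ∈ so, ((coefo j q : ℝ) : ℂ) * ((x : ℂ)) ^ q)).im / Real.sqrt (2 * a)) * Λ1o j i)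
                (fun j' : Fin ro ↦ (((weilWindowSesq a ((Icc (-a) a).indicator fun x : ℝ ↦ ∑ q ∈ so, ((coefo j' q : ℝ) : ℂ) * ((x : ℂ)) ^ q) (chiOdd a (m + 1))).im / Real.sqrt 2)
                - ∑ k ∈ Finset.Ico 0 Bo, ((gramCoeff a ((k : ℤ) + 1) ((m : ℤ) + 1) - gramCoeff a ((k : ℤ) + 1) (-((m : ℤ) + 1))) / 2) * (2 * (Yoshida1992.fourierCoeff a ((k : ℤ) + 1) ((Icc (-a) a).indicator fun x : ℝ ↦ ∑ q ∈ so, ((coefo j' q : ℝ) : ℂ) * ((x : ℂ)) ^ q)).im / Real.sqrt (2 * a)))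
                  - ∑ j, (2 * (Yoshida1992.fourierCoeff a ((m : ℤ) + 1) ((Icc (-a) a).indicator fun x : ℝ ↦ ∑ q ∈ so, ((coefo j q : ℝ) : ℂ) * ((x : ℂ)) ^ q)).im / Real.sqrt (2 * a)) * Λ2o j j') k * Sum.elim x β k) ^ 2 / dod m := by
    intro m _
    have h1 : ∑ j, ((weilWindowSesq a ((Icc (-a) a).indicator (fun x : ℝ ↦ ∑ q ∈ so, ((coefo j q : ℝ) : ℂ) * ((x : ℂ)) ^ q)
              - proj a Bo ((Icc (-a) a).indicator fun x : ℝ ↦ ∑ q ∈ so, ((coefo j q : ℝ) : ℂ) * ((x : ℂ)) ^ q))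
              (chiOdd a (m + 1))).im / Real.sqrt 2) * β j
        = ∑ j, (((weilWindowSesq a ((Icc (-a) a).indicator fun x : ℝ ↦ ∑ q ∈ so, ((coefo j q : ℝ) : ℂ) * ((x : ℂ)) ^ q) (chiOdd a (m + 1))).im / Real.sqrt 2)
                - ∑ k ∈ Finset.Ico 0 Bo, ((gramCoeff a ((k : ℤ) + 1) ((m : ℤ) + 1) - gramCoeff a ((k : ℤ) + 1) (-((m : ℤ) + 1))) / 2) * (2 * (Yoshida1992.fourierCoeff a ((k : ℤ) + 1) ((Icc (-a) a).indicator fun x : ℝ ↦ ∑ q ∈ so, ((coefo j q : ℝ) : ℂ) * ((x : ℂ)) ^ q)).im / Real.sqrt (2 * a))) * β j :=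
      Finset.sum_congr rfl fun j _ ↦ by rw [im_weilWindowSesq_sub_proj_chiOdd_div ha (hodI j) (hreI j) (hwin j) Bo m]
    have h2 := threePart_linearForm_eq (fun i : Fin Bo ↦ ((gramCoeff a (((i : ℕ) : ℤ) + 1) ((m : ℤ) + 1) - gramCoeff a (((i : ℕ) : ℤ) + 1) (-((m : ℤ) + 1))) / 2))
      (fun j : Fin ro ↦ (((weilWindowSesq a ((Icc (-a) a).indicator fun x : ℝ ↦ ∑ q ∈ so, ((coefo j q : ℝ) : ℂ) * ((x : ℂ)) ^ q) (chiOdd a (m + 1))).im / Real.sqrt 2)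
                - ∑ k ∈ Finset.Ico 0 Bo, ((gramCoeff a ((k : ℤ) + 1) ((m : ℤ) + 1) - gramCoeff a ((k : ℤ) + 1) (-((m : ℤ) + 1))) / 2) * (2 * (Yoshida1992.fourierCoeff a ((k : ℤ) + 1) ((Icc (-a) a).indicator fun x : ℝ ↦ ∑ q ∈ so, ((coefo j q : ℝ) : ℂ) * ((x : ℂ)) ^ q)).im / Real.sqrt (2 * a))))
      (fun j : Fin ro ↦ (2 * (Yoshida1992.fourierCoeff a ((m : ℤ) + 1) ((Icc (-a) a).indicator fun x : ℝ ↦ ∑ q ∈ so, ((coefo j q : ℝ) : ℂ) * ((x : ℂ)) ^ q)).im / Real.sqrt (2 * a))) Λ1o Λ2o x β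
    beta_reduce at h2
    rw [h1, h2]
  rw [Finset.sum_congr rfl hsum]
  exact columns_majorant_sum (Finset.Ico Bo m₀o) (fun m ↦ Sum.elim
                (fun i : Fin Bo ↦ ((gramCoeff a (((i : ℕ) : ℤ) + 1) ((m : ℤ) + 1) - gramCoeff a (((i : ℕ) : ℤ) + 1) (-((m : ℤ) + 1))) / 2)
                  - ∑ j, (2 * (Yoshida1992.fourierCoeff a ((m : ℤ) + 1) ((Icc (-a) a).indicator fun x : ℝ ↦ ∑ q ∈ so, ((coefo j q : ℝ) : ℂ) * ((x : ℂ)) ^ q)).im / Real.sqrt (2 * a)) * Λ1o j i)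
                (fun j' : Fin ro ↦ (((weilWindowSesq a ((Icc (-a) a).indicator fun x : ℝ ↦ ∑ q ∈ so, ((coefo j' q : ℝ) : ℂ) * ((x : ℂ)) ^ q) (chiOdd a (m + 1))).im / Real.sqrt 2)
                - ∑ k ∈ Finset.Ico 0 Bo, ((gramCoeff a ((k : ℤ) + 1) ((m : ℤ) + 1) - gramCoeff a ((k : ℤ) + 1) (-((m : ℤ) + 1))) / 2) * (2 * (Yoshida1992.fourierCoeff a ((k : ℤ) + 1) ((Icc (-a) a).indicator fun x : ℝ ↦ ∑ q ∈ so, ((coefo j' q : ℝ) : ℂ) * ((x : ℂ)) ^ q)).im / Real.sqrt (2 * a)))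
                  - ∑ j, (2 * (Yoshida1992.fourierCoeff a ((m : ℤ) + 1) ((Icc (-a) a).indicator fun x : ℝ ↦ ∑ q ∈ so, ((coefo j q : ℝ) : ℂ) * ((x : ℂ)) ^ q)).im / Real.sqrt (2 * a)) * Λ2o j j')) dod w hw (Sum.elim x β)

end Summit.RiemannHypothesis.RiemannHypothesis.Theorems.WeilFormatC

end
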